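import Mathlib.LinearAlgebra.Matrix.GeneralLinearGroup.Basic
import Literature.Barriers.MatrixMultiplication.QuasirandomBarrierLieTypeProofs
import Literature.Barriers.MatrixMultiplication.NormalizerBarrier
import Literature.RepresentationTheory.FiniteGroups.GLnMinimalCharacterDegree
import HarnessLib

/-!
# Barrier (sequel to `QuasirandomBarrier.lean`): the full linear groups `GL(n, q)`
# (BCGPU 2023, §3.2: "triples of subgroups in `GL(n,q)` with fixed `n` cannot meet the packing
# bound" and, footnote, "more generally, arbitrary subsets cannot meet the packing bound")

Topic `Literature/Barriers/MatrixMultiplication` (D-0021 catalogue for the summit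
`MatrixMultiplication`, `ω(ℂ) = 2`); fourth file attached to the catalogue entry `QuasirandomBarrier`
(Thm. 3.2 = `BCGPU2023_thm32`, PROVED in `QuasirandomBarrierProofs.lean`; Cor. 3.4 for `SL(n, q)`,
`PSL(n, q)` = `BCGPU2023_cor34_typeA`, PROVED in `QuasirandomBarrierLieTypeProofs.lean`).
Everything here is **proved**; no definition, no named fact.

Source.  J. Blasiak, H. Cohn, J. A. Grochow, K. Pratt, C. Umans, *Matrix multiplication via matrix
groups*, ITCS 2023, LIPIcs 251, 19:1–19:16 = arXiv:2204.03826 [BlasiakCohnGrochowPrattUmans2023];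
held copy `paper:arxiv-2204.03826` read with `lit read` this session (chunk p0007 = p. 7, §3.2,
between Remark 3.7 and Cor. 3.8), verbatim:

> "The following corollary shows that triple product property constructions using subgroups of
> groups `G` satisfying `|Z(G)| = Ω(|G|^δ)` with `δ>0` cannot meet the packing bound. For example,
> this shows that triples of subgroups in `GL(n,q)` with fixed `n` cannot meet the packing
> bound.[Footnote: More generally, arbitrary subsets cannot meet the packing bound, because
> intersecting random translates of the subsets with `SL(n,q)` would give subsets of `SL(n,q)`
> meeting the packing bound in expectation, and we have seen that this is impossible since `SL(n,q)`
> [is] a group of Lie type of bounded rank when `n` is fixed.]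
> Corollary 3.8. If subgroups `H₁`, `H₂`, and `H₃` satisfy the triple product property in a finite
> group `G`, then `|H₁||H₂||H₃| ≤ |G|^{3/2}/|Z(G)|^{1/2}`."

and §2, p. 5 (after Def. 2.3): "Meeting the packing bound is a necessary condition for Thm. 2.2 to
yield `ω=2`: if a family of groups contains no sequence meeting the packing bound, then there is a
constant `ε>0` such that no group in the family can prove an upper bound on `ω` better than `2+ε`
via Thm. 2.2."

## What is proved (all `n = m + 1`, `F` a finite field with `q` elements, `G = GL_n(F)`)

* §1 `GLn.card_le_pow` (`|G| ≤ q^{n²}`), `GLn.natCard_center` (`|Z(G)| = q − 1`, from Mathlib's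
  `Matrix.GeneralLinearGroup.center_eq_range_scalar`), **`secondCharDegree_GL_ge`**
  (`n(GL_n(q)) ≥ q^{n−1}/4` for `n ≥ 2`, from the tree's transfer of Landazuri–Seitz Lemma 3.1 to
  `GL_n`, `GLn.card_le_two_mul_charDegree_add_one` / `GLn.le_charDegree_of_three_le`).
* §2 **Subgroups** — the printed sentence, effective: `SubgroupTPP.card_mul_le_GL`,
  `|H₁||H₂||H₃| ≤ |GL_n(F)|^{3/2}/√(q − 1)` (Cor. 3.8 = the tree's `SubgroupTPP.center_barrier`,
  PROVED in `NormalizerBarrier.lean`, with `|Z(GL_n(F))| = q − 1`).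
* §3 **Arbitrary subsets** — the footnote, effective: `tpp_card_le_GL`, for every TPP triple
  `S, T, U ⊆ GL_n(F)`, `n ≥ 2`: `|S||T||U| ≤ 2|G|^{3/2}/√(q^{n−1}) + |G|`; and in the `|G|^δ`
  form of Cor. 3.3, `tpp_card_le_GL_rpow`: `|S||T||U| ≤ 2|G|^{3/2 − (n−1)/(2n²)} + |G|` — for `n`
  fixed this is `O(|G|^{3/2 − δ_n})`, `δ_n = (n−1)/(2n²) > 0`, so no sequence `GL(n, qᵢ)` meets
  the packing bound `|G|^{3/2 − o(1)}` (Def. 2.3).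
* §4 **No certificate below `2 + ε`** — the §2 remark applied to the family of ALL `GL(n, q)`:
  `BCGPU2023_noCertificate_GL`, ONE absolute `ε > 0` such that for every finite field `F` and
  every `n ≥ 2`, every TPP triple in `GL_n(F)` satisfies the inequality of Thm. 2.2 (= Cohn–Umans
  2003 Thm. 4.1 / CKSU 2005 Thm. 1.8, the tree's `CKSU2005_thm18`, right-hand side
  `charDegreePowSum G w`) AT `w = 2 + ε` — the catalogue's effective reading "cannot yield an upper
  bound on `ω` better than `2 + ε`", exactly as for `BCGPU2023_cor34_typeA`.  Obtained from the
  tree's abstract family theorem `exists_eps_noCertificate_family` (the printed Cor. 3.4 argument: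
  bounded rank by Cor. 3.3, large rank by "few conjugacy classes" and convexity) with the inputs
  `n(GL_n(q)) ≥ q^{n−1}/4`, `k(GL_n(q)) ≤ q^{2n}` (`card_conjClasses_GL_le_pow`, PROVED in
  `GLnClassNumberBound.lean`) and `|GL_n(q)| ≤ q^{n²}`.

## Rendering, deviations from print, wording risks

* The paper states the `GL(n, q)` claims for FIXED `n` (and `GL(n, q)` is not a "group of Lie type"
  in the paper's sense — footnote p. 3: "the fixed points of a Steinberg endomorphism in a
  SEMISIMPLE algebraic group", which excludes the reductive `GL_n`; Cor. 3.4 itself does not name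
  `GL(n, q)`).  §2–§3 are the fixed-`n` statements made effective in `q` AND `n`; §4 is uniform in
  `n` as well, which the printed Cor. 3.4 argument yields verbatim once `k(GL_n(q)) ≤ q^{2n}` is
  available — a consequence of the printed method, proved here, not a sentence of the paper.
* The footnote's own route (random translates meeting `SL(n, q)`, then the bounded-rank barrier in
  `SL(n, q)`) is NOT the route formalized: losing the factor `(q − 1)³ ≈ |SL_n(q)|^{3/(n²−1)}` it
  closes, read literally against Def. 2.3, only for `n ≥ 5`.  Instead Thm. 3.2 is applied in the
  non-abelian group `GL(n, q)` itself, whose second-smallest character degree is controlled by that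
  of `SL(n, q)` (restriction to `SL_n ⊇ GL_n'`, `GLnMinimalCharacterDegree.lean`) — the same
  mechanism ("`SL(n,q)` is quasirandom of bounded rank"), in character-theoretic form, valid for all
  `n ≥ 2`.
* `n(G) = secondCharDegree G` (Def. 3.1), `TripleProductProperty` (Cohn–Umans Def. 2.1, the tree's,
  on `Finset`s), `SubgroupTPP` (Def. 2.1 for subgroups, `NormalizerBarrier.lean`), "meet the packing
  bound" rendered effectively by explicit upper bounds (no sequence-level definition in the tree, as
  in every sibling entry).

WHAT THIS IS NOT: no statement about `ω`; nothing about the other classical groups `GU`, `GSp`, `GO`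
(not in Mathlib over finite fields with their representation theory), about direct powers
`GL(n, q)^m` (the SUBGROUP sentence of §1.1 "or even inside products of such groups" is proved in the
sequel `NormalizerBarrierGLnProducts.lean`, `SubgroupTPP.card_mul_le_GL_pi` / `_GL_pow`, 2026-08-27;
subsets of powers remain the direct-product escape), or about STPP families; the constant `ε` is not computed in closed form (it is the
`ε` of `exists_eps_noCertificate_family`, `min(1/200, ε₂, ε₃)`).
-/

noncomputable section

open scoped BigOperators
open Matrix

namespace Literature.Barriers.MatrixMultiplication

open Literature.RepresentationTheory.FiniteGroups Literature.Combinatorics.Additive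

/-! ## §1 Numerical inputs for `GL_n(𝔽_q)`: order, centre, second-smallest character degree -/

section Inputs

variable {F : Type} [Field F] [Fintype F] [DecidableEq F] {m : ℕ}

/-- `|GL_{m+1}(F)| ≤ q^{(m+1)²}` (a subset of the `(m+1) × (m+1)` matrices; "`|G| = Θ(q^d)`" with
`d = n²` for `GL_n`). [cite: BlasiakCohnGrochowPrattUmans2023, Cor. 3.4 (proof: "`|G| = Θ(q^d)`")] -/
theorem GLn.card_le_pow : Fintype.card (GL (Fin (m + 1)) F) ≤ Fintype.card F ^ ((m + 1) * (m + 1)) := by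
  calc Fintype.card (GL (Fin (m + 1)) F)
      ≤ Fintype.card (Matrix (Fin (m + 1)) (Fin (m + 1)) F) :=
        Fintype.card_le_of_injective _ Units.val_injective
    _ = Fintype.card F ^ ((m + 1) * (m + 1)) := by
        change Fintype.card (Fin (m + 1) → Fin (m + 1) → F) = _
        rw [Fintype.card_fun, Fintype.card_fun, Fintype.card_fin, ← pow_mul, mul_comm]

omit [DecidableEq F] in
/-- **`|Z(GL_n(F))| = q − 1`** (`n ≥ 1`): the centre of `GL_n` is the group of scalar matrices
(Mathlib's `Matrix.GeneralLinearGroup.center_eq_range_scalar`), isomorphic to `F^×`.  This is the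
"`|Z(G)| = Ω(|G|^δ)`" input of the printed example (`δ = 1/n²`).
[cite: BlasiakCohnGrochowPrattUmans2023, §3.2 (paragraph before Cor. 3.8)] -/
theorem GLn.natCard_center : Nat.card (Subgroup.center (GL (Fin (m + 1)) F)) = Fintype.card F - 1 := by
  classical
  have hinj : Function.Injective (GeneralLinearGroup.scalar (Fin (m + 1)) : Fˣ →* GL (Fin (m + 1)) F) := by
    intro u v huv
    apply Units.ext
    have h := congrArg (fun g : GL (Fin (m + 1)) F => (g : Matrix (Fin (m + 1)) (Fin (m + 1)) F) 0 0) huv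
    simpa [GeneralLinearGroup.coe_scalar] using h
  rw [GeneralLinearGroup.center_eq_range_scalar,
    ← Nat.card_congr (MonoidHom.ofInjective hinj).toEquiv, Nat.card_eq_fintype_card, Fintype.card_units]

/-- `n(G)` is a character degree `> 1` of a non-abelian finite group (Serre Thm. 9). [folklore] -/
private theorem secondCharDegree_mem' {G : Type} [Group G] [Finite G] (hG : ∃ a b : G, a * b ≠ b * a) :
    secondCharDegree G ∈ charDegrees G ∧ 1 < secondCharDegree G := by
  have hne' : {d : ℕ | d ∈ charDegrees G ∧ 1 < d}.Nonempty := by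
    obtain ⟨d, hd, h1⟩ := Serre1977_thm9_holds.exists_one_lt_mem_charDegrees G hG
    exact ⟨d, hd, h1⟩
  exact Nat.sInf_mem hne'

/-- **`n(GL_{m+1}(q)) ≥ q^m/4`** (`m ≥ 1`) — the quasirandomness input "`n(G) ≥ Ω(q^r)`" for the full
linear group: from Landazuri–Seitz Lemma 3.1 transferred to `GL_n` in the tree
(`GLn.card_le_two_mul_charDegree_add_one`: `(q−1)/2 ≥ q/4` for `m = 1`;
`GLn.le_charDegree_of_three_le`: `q^m − 1 ≥ q^m/2` for `m ≥ 2`).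
[cite: BlasiakCohnGrochowPrattUmans2023, Cor. 3.4 (proof: "`n(G) ≥ Ω(q^r)` holds by [Landazuri–Seitz]") and §3.2 (footnote before Cor. 3.8)] -/
theorem secondCharDegree_GL_ge (hm : 1 ≤ m) :
    (Fintype.card F : ℝ) ^ m / 4 ≤ secondCharDegree (GL (Fin (m + 1)) F) := by
  have hq : 2 ≤ Fintype.card F := Fintype.one_lt_card
  have hq' : (2 : ℝ) ≤ Fintype.card F := by exact_mod_cast hq
  obtain ⟨hmem, h1⟩ := secondCharDegree_mem' (GLn.exists_not_commute (F := F) hm)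
  rcases Nat.lt_or_ge m 2 with hlt | hge
  · obtain rfl : m = 1 := by omega
    have h := GLn.card_le_two_mul_charDegree_add_one (F := F) le_rfl hmem h1
    have h' : (Fintype.card F : ℝ) ≤ 2 * secondCharDegree (GL (Fin (1 + 1)) F) + 1 := by
      exact_mod_cast h
    rw [pow_one]
    linarith
  · have h := GLn.le_charDegree_of_three_le (F := F) hge hmem h1
    have hpow : 1 ≤ Fintype.card F ^ m := Nat.one_le_pow _ _ (by omega)
    have h' : (Fintype.card F : ℝ) ^ m - 1 ≤ secondCharDegree (GL (Fin (m + 1)) F) := by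
      have := (Nat.cast_le (α := ℝ)).mpr h
      push_cast [Nat.cast_sub hpow] at this
      exact this
    have h2m : (2 : ℝ) ≤ (Fintype.card F : ℝ) ^ m := by
      calc (2 : ℝ) = 2 ^ 1 := by norm_num
        _ ≤ (Fintype.card F : ℝ) ^ 1 := by rw [pow_one, pow_one]; exact hq'
        _ ≤ (Fintype.card F : ℝ) ^ m := pow_le_pow_right₀ (by linarith) hm
    linarith

/-- The same bound as a power of the ORDER: `n(GL_{m+1}(q)) ≥ (1/4)|GL_{m+1}(q)|^{m/(m+1)²}`
(`q^m ≥ |G|^{m/(m+1)²}` since `|G| ≤ q^{(m+1)²}`) — the hypothesis "`n(G) ≥ c|G|^δ`" of Cor. 3.3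
with `c = 1/4`, `δ = m/(m+1)²`. [cite: BlasiakCohnGrochowPrattUmans2023, Cor. 3.3 and §3.2 (footnote before Cor. 3.8)] -/
theorem secondCharDegree_GL_ge_rpow (hm : 1 ≤ m) :
    (1 / 4 : ℝ) * (Fintype.card (GL (Fin (m + 1)) F) : ℝ) ^ ((m : ℝ) / ((m + 1) * (m + 1) : ℕ)) ≤
      secondCharDegree (GL (Fin (m + 1)) F) := by
  have hq0 : (0 : ℝ) ≤ Fintype.card F := Nat.cast_nonneg _
  have hG0 : (0 : ℝ) ≤ Fintype.card (GL (Fin (m + 1)) F) := Nat.cast_nonneg _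
  have hN : (0 : ℝ) < (((m + 1) * (m + 1) : ℕ) : ℝ) := by positivity
  have hcard : (Fintype.card (GL (Fin (m + 1)) F) : ℝ) ≤ (Fintype.card F : ℝ) ^ ((m + 1) * (m + 1)) := by
    exact_mod_cast GLn.card_le_pow (F := F) (m := m)
  have h1 : (Fintype.card (GL (Fin (m + 1)) F) : ℝ) ^ ((m : ℝ) / ((m + 1) * (m + 1) : ℕ)) ≤
      ((Fintype.card F : ℝ) ^ ((m + 1) * (m + 1))) ^ ((m : ℝ) / ((m + 1) * (m + 1) : ℕ)) :=
    Real.rpow_le_rpow hG0 hcard (by positivity)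
  have h2 : ((Fintype.card F : ℝ) ^ ((m + 1) * (m + 1))) ^ ((m : ℝ) / ((m + 1) * (m + 1) : ℕ)) =
      (Fintype.card F : ℝ) ^ m := by
    rw [← Real.rpow_natCast, ← Real.rpow_mul hq0, mul_div_cancel₀ _ hN.ne', Real.rpow_natCast]
  have h3 := secondCharDegree_GL_ge (F := F) hm
  rw [h2] at h1
  linarith

end Inputs

/-! ## §2 Subgroups of `GL(n, q)`: Cor. 3.8 with `|Z(GL_n(q))| = q − 1` -/

section Subgroups

variable {F : Type} [Field F] [Fintype F] {m : ℕ}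

/-- **"Triples of subgroups in `GL(n,q)` with fixed `n` cannot meet the packing bound"**, effective:
subgroups `H₁, H₂, H₃ ≤ GL_n(F)` with the triple product property satisfy
`|H₁||H₂||H₃| ≤ |GL_n(F)|^{3/2}/√(q − 1)` — Cor. 3.8 (the tree's `SubgroupTPP.center_barrier`) with
`|Z(GL_n(F))| = q − 1` (`GLn.natCard_center`).  For `n` fixed, `q − 1 = Θ(|G|^{1/n²})`.
[cite: BlasiakCohnGrochowPrattUmans2023, Cor. 3.8 and §3.2 (paragraph before it)] -/
theorem SubgroupTPP.card_mul_le_GL {H₁ H₂ H₃ : Subgroup (GL (Fin (m + 1)) F)} (h : SubgroupTPP H₁ H₂ H₃) :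
    ((Nat.card H₁ * Nat.card H₂ * Nat.card H₃ : ℕ) : ℝ) ≤
      (Nat.card (GL (Fin (m + 1)) F) : ℝ) ^ (3 / 2 : ℝ) / Real.sqrt (Fintype.card F - 1 : ℕ) := by
  have h' := h.center_barrier
  rwa [GLn.natCard_center] at h'

end Subgroups

/-! ## §3 Arbitrary subsets of `GL(n, q)`: Thm. 3.2 with `n(GL_n(q)) ≥ q^{n−1}/4` -/

section Subsets

variable {F : Type} [Field F] [Fintype F] [DecidableEq F] {m : ℕ}

/-- **"More generally, arbitrary subsets [of `GL(n,q)`, `n` fixed] cannot meet the packing bound"**,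
effective: every TPP triple `S, T, U ⊆ GL_{m+1}(F)`, `m ≥ 1`, has
`|S||T||U| ≤ 2|G|^{3/2}/√(q^m) + |G|` (Thm. 3.2, the tree's `BCGPU2023_thm32_holds`, with
`n(G) ≥ q^m/4`).  [cite: BlasiakCohnGrochowPrattUmans2023, Thm. 3.2 and §3.2 (footnote before Cor. 3.8)] -/
theorem tpp_card_le_GL (hm : 1 ≤ m) (S T U : Finset (GL (Fin (m + 1)) F))
    (hTPP : TripleProductProperty S T U) :
    ((S.card * T.card * U.card : ℕ) : ℝ) ≤
      2 * (Fintype.card (GL (Fin (m + 1)) F) : ℝ) ^ (3 / 2 : ℝ) / Real.sqrt ((Fintype.card F : ℝ) ^ m) +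
        Fintype.card (GL (Fin (m + 1)) F) := by
  set g : ℝ := (Fintype.card (GL (Fin (m + 1)) F) : ℝ) with hg
  set ν : ℝ := ((secondCharDegree (GL (Fin (m + 1)) F) : ℕ) : ℝ) with hν
  have h32 := BCGPU2023_thm32_holds (GL (Fin (m + 1)) F) (GLn.exists_not_commute hm) S T U hTPP
  have hνq : (Fintype.card F : ℝ) ^ m / 4 ≤ ν := secondCharDegree_GL_ge hm
  have hq0 : (0 : ℝ) < (Fintype.card F : ℝ) ^ m := by
    have : (0 : ℝ) < Fintype.card F := by exact_mod_cast Fintype.card_pos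
    positivity
  have hsq : Real.sqrt ((Fintype.card F : ℝ) ^ m) / 2 ≤ Real.sqrt ν := by
    rw [div_le_iff₀ (by norm_num : (0 : ℝ) < 2), show (2 : ℝ) = Real.sqrt 4 by
      rw [show (4 : ℝ) = 2 ^ 2 by norm_num, Real.sqrt_sq (by norm_num)], ← Real.sqrt_mul' _ (by norm_num)]
    exact Real.sqrt_le_sqrt (by linarith)
  have hsq0 : 0 < Real.sqrt ((Fintype.card F : ℝ) ^ m) / 2 := by positivity
  have hg0 : 0 ≤ g ^ (3 / 2 : ℝ) := by positivity
  have hmono : g ^ (3 / 2 : ℝ) / Real.sqrt ν ≤ g ^ (3 / 2 : ℝ) / (Real.sqrt ((Fintype.card F : ℝ) ^ m) / 2) :=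
    div_le_div_of_nonneg_left hg0 hsq0 hsq
  rw [div_div_eq_mul_div, mul_comm] at hmono
  rw [← hg, ← hν] at h32
  linarith [h32, hmono]

/-- The same in the `|G|^δ` form of Cor. 3.3: every TPP triple in `G = GL_{m+1}(F)`, `m ≥ 1`, has
`|S||T||U| ≤ 2|G|^{3/2 − m/(2(m+1)²)} + |G|` (the tree's `BCGPU2023_thm32.cor33` with `c = 1/4`,
`δ = m/(m+1)²`) — bounded away from the packing bound `|G|^{3/2 − o(1)}` for `n = m + 1` fixed.
[cite: BlasiakCohnGrochowPrattUmans2023, Cor. 3.3 and §3.2 (footnote before Cor. 3.8)] -/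
theorem tpp_card_le_GL_rpow (hm : 1 ≤ m) (S T U : Finset (GL (Fin (m + 1)) F))
    (hTPP : TripleProductProperty S T U) :
    ((S.card * T.card * U.card : ℕ) : ℝ) ≤
      2 * (Fintype.card (GL (Fin (m + 1)) F) : ℝ) ^ (3 / 2 - (m : ℝ) / ((m + 1) * (m + 1) : ℕ) / 2 : ℝ) +
        Fintype.card (GL (Fin (m + 1)) F) := by
  have h := BCGPU2023_thm32_holds.cor33 (GL (Fin (m + 1)) F) (GLn.exists_not_commute hm)
    (c := 1 / 4) (δ := (m : ℝ) / ((m + 1) * (m + 1) : ℕ)) (by norm_num)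
    (secondCharDegree_GL_ge_rpow hm) S T U hTPP
  have hs : Real.sqrt (1 / 4 : ℝ) = 1 / 2 := by
    rw [show (1 / 4 : ℝ) = (1 / 2) ^ 2 by norm_num, Real.sqrt_sq (by norm_num)]
  rw [hs] at h
  have e : (Fintype.card (GL (Fin (m + 1)) F) : ℝ) ^ (3 / 2 - (m : ℝ) / ((m + 1) * (m + 1) : ℕ) / 2 : ℝ) / (1 / 2) =
      2 * (Fintype.card (GL (Fin (m + 1)) F) : ℝ) ^ (3 / 2 - (m : ℝ) / ((m + 1) * (m + 1) : ℕ) / 2 : ℝ) := by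
    ring
  linarith [h, e]

end Subsets

/-! ## §4 The family of all `GL(n, q)`: no certificate below `2 + ε` via Thm. 2.2 -/

section NoCertificate

/-- **BCGPU 2023, §2 with §3 for the full linear groups**: there is ONE absolute `ε > 0` such that
for every finite field `F` and every `n ≥ 2`, every triple `S, T, U ⊆ GL_n(F)` with the triple
product property satisfies the inequality of Thm. 2.2 (Cohn–Umans) AT `w = 2 + ε`:
`(|S||T||U|)^{(2+ε)/3} ≤ ∑ᵢ dᵢ^{2+ε}` — Thm. 2.2 certifies no bound `ω < 2 + ε` from any TPP
construction in any `GL(n, q)`.  Printed for fixed `n` ("cannot meet the packing bound", hence, by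
the §2 remark, no bound better than `2 + ε_n`); the uniformity in `n` is the Cor. 3.4 argument
(the tree's `exists_eps_noCertificate_family`) run with `n(GL_n(q)) ≥ q^{n−1}/4`
(`secondCharDegree_GL_ge`), `k(GL_n(q)) ≤ q^{2n}` (`card_conjClasses_GL_le_pow`) and
`|GL_n(q)| ≤ q^{n²}` — a consequence of the printed method proved here, see the module docstring.
[cite: BlasiakCohnGrochowPrattUmans2023, §3.2 (paragraph and footnote before Cor. 3.8), §2 (after Def. 2.3) and Cor. 3.4 (proof)] -/
theorem BCGPU2023_noCertificate_GL :
    ∃ ε : ℝ, 0 < ε ∧ ∀ (F : Type) [Field F] [Fintype F] (n : ℕ), 2 ≤ n →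
      ∀ (S T U : Finset (GL (Fin n) F)), TripleProductProperty S T U →
        ((S.card * T.card * U.card : ℕ) : ℝ) ^ ((2 + ε) / 3) ≤
          charDegreePowSum (GL (Fin n) F) (2 + ε) := by
  classical
  obtain ⟨ε, hε, hfam⟩ := exists_eps_noCertificate_family
  refine ⟨ε, hε, ?_⟩
  intro F _ _ n hn S T U hTPP
  obtain ⟨m, rfl⟩ : ∃ m, n = m + 1 := ⟨n - 1, by omega⟩
  have hm : 1 ≤ m := by omega
  set q : ℕ := Fintype.card F with hq
  have hq2 : 2 ≤ q := Fintype.one_lt_card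
  have hk : (Nat.card (ConjClasses (GL (Fin (m + 1)) F)) : ℝ) ≤ (q : ℝ) ^ (2 * m + 3) := by
    have h1 : Nat.card (ConjClasses (GL (Fin (m + 1)) F)) ≤ q ^ (2 * m + 3) :=
      calc Nat.card (ConjClasses (GL (Fin (m + 1)) F)) ≤ q ^ (2 * (m + 1)) :=
            card_conjClasses_GL_le_pow F (m + 1)
        _ ≤ q ^ (2 * m + 3) := Nat.pow_le_pow_right (by omega) (by omega)
    exact_mod_cast h1
  have hcard : (Fintype.card (GL (Fin (m + 1)) F) : ℝ) ≤ (q : ℝ) ^ ((m + 1) * (m + 1)) := by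
    exact_mod_cast GLn.card_le_pow (F := F) (m := m)
  exact hfam q m hq2 hm _ (GLn.exists_not_commute hm) (secondCharDegree_GL_ge hm) hk hcard S T U hTPP

end NoCertificate

end Literature.Barriers.MatrixMultiplication

end
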